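import Summits.ValiantsHypothesis.ValiantsHypothesis.Theorems.KPlusLogSqLawValuativeDoorProducts
import Summits.ValiantsHypothesis.ValiantsHypothesis.Theorems.KPlusLogSqLawValuativeDoorSquaring

/-!
# LINE `valuative_door` (crux `WeakLifting`, stmt-ValiantsHypothesis-19561) — THE NEWTON POLYGON DICTIONARY (split case):
# `domCount v f = 1 + #{v α : f(α) = 0}` and `npEdges v f = #{v α : f(α) = 0}` for a split `f` with `f(0) ≠ 0`

HONEST FRAMING.  Helper (cell `pub-symmetroid`, seat val-sym-lift-p1 g23, 2026-08-29; `--supports 19561 --as helper`).  The skeleton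
header of `Cruxes/WeakLifting/Lines/valuative_door.lean` asks, as the «CLAIM TO BE PROVED IN THE FIRST HELPER FILE (used silently by every
prose argument)», that for non-archimedean `v` the count `domCount v f` is the number of Newton-polygon vertices and `npEdges v f` the
number of distinct absolute values of the roots of `f` when `f(0) ≠ 0`.  This file proves the SPLIT CASE on the raw predicate: for
`f = C c · Π_{a ∈ m} (X − C a)` with `c ≠ 0` and `0 ∉ m`, the dominant exponents are EXACTLY the counts `#{a ∈ m : v a < t}` at the radii
`t > 0` avoiding the root radii (`dominant_prod_roots`, by `…Products.dominant_mul` and the two-term analysis of `X − C a`), no exponent is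
dominant at a root radius (a factor `X − C a` with `v a = t` ties, `…Products.exists_dominant_pair_of_dominant_mul`), and the counts take
exactly `1 + #{v a : a ∈ m}` values — hence `domCount = 1 + #(root radii)` (`domCount_C_mul_prod_roots`) and, for split `f` with
`f(0) ≠ 0`, `domCount v f = 1 + #(f.roots.map v).toFinset` (`domCount_of_splits`), i.e. `npEdges v f` = the number of distinct root
absolute values.  (The general case follows by passing to a splitting field with an extension of `v`; not needed by the line's rows and
not done here.)  Dictionary lemma only; no bearing on vW / vB, `TropicalB`, `MatrixDescartes` (18050) or VP ≠ VNP.  [Newton polygon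
folklore, kernel on the raw predicate]
-/

set_option linter.dupNamespace false
set_option autoImplicit false

namespace Summit.ValiantsHypothesis.ValiantsHypothesis.Theorems.KPlusLogSqLaw.ValDoor

open Polynomial Finset
open scoped BigOperators Classical

variable {F : Type*} [Field F]

/-! ## §1 The linear factor `X − C a` -/

/-- below the root radius the constant term of `X − C a` strictly dominates. [two terms] -/
theorem dominantAt_X_sub_C_zero (v : AbsoluteValue F ℝ) (a : F) {t : ℝ} (ht : 0 < t) (hta : t < v a) :
    ∀ x : ℕ, x ≠ 0 → v ((X - C a).coeff x) * t ^ x < v ((X - C a).coeff 0) * t ^ 0 := by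
  intro x hx
  have h0 : (X - C a : F[X]).coeff 0 = -a := by simp
  rw [h0, v.map_neg, pow_zero, mul_one]
  rcases Nat.exists_eq_succ_of_ne_zero hx with ⟨y, rfl⟩
  rcases Nat.eq_zero_or_pos y with rfl | hy
  · have h1 : (X - C a : F[X]).coeff 1 = 1 := by simp
    rw [h1, map_one, one_mul, pow_one]
    exact hta
  · have h2 : (X - C a : F[X]).coeff (y + 1) = 0 := by
      rw [coeff_sub, coeff_X, coeff_C, if_neg (by omega), if_neg (by omega), sub_zero]
    rw [h2, map_zero, zero_mul]
    exact ht.trans hta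

/-- above the root radius the leading term of `X − C a` strictly dominates. [two terms] -/
theorem dominantAt_X_sub_C_one (v : AbsoluteValue F ℝ) (a : F) {t : ℝ} (hat : v a < t) :
    ∀ x : ℕ, x ≠ 1 → v ((X - C a).coeff x) * t ^ x < v ((X - C a).coeff 1) * t ^ 1 := by
  intro x hx
  have h1 : (X - C a : F[X]).coeff 1 = 1 := by simp
  rw [h1, map_one, one_mul, pow_one]
  have ht : 0 < t := (v.nonneg a).trans_lt hat
  rcases Nat.eq_zero_or_pos x with rfl | hx0
  · have h0 : (X - C a : F[X]).coeff 0 = -a := by simp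
    rw [h0, v.map_neg, pow_zero, mul_one]
    exact hat
  · have h2 : (X - C a : F[X]).coeff x = 0 := by
      rw [coeff_sub, coeff_X, coeff_C, if_neg (by omega), if_neg (by omega), sub_zero]
    rw [h2, map_zero, zero_mul]
    exact ht

/-- AT the root radius no exponent of `X − C a` strictly dominates (the two terms tie). [two terms] -/
theorem not_dominantAt_X_sub_C (v : AbsoluteValue F ℝ) (a : F) (x : ℕ) :
    ¬ ∀ x' : ℕ, x' ≠ x → v ((X - C a).coeff x') * (v a) ^ x' < v ((X - C a).coeff x) * (v a) ^ x := by
  intro h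
  have h0 : (X - C a : F[X]).coeff 0 = -a := by simp
  have h1 : (X - C a : F[X]).coeff 1 = 1 := by simp
  rcases Nat.eq_zero_or_pos x with rfl | hx0
  · have := h 1 one_ne_zero
    rw [h0, h1, v.map_neg, map_one, one_mul, pow_one, pow_zero, mul_one] at this
    exact lt_irrefl _ this
  · rcases eq_or_lt_of_le (Nat.succ_le_of_lt hx0) with hx1 | hx2
    · have := h 0 (by omega)
      rw [← hx1, h0, h1, v.map_neg, map_one, one_mul, pow_one, pow_zero, mul_one] at this
      exact lt_irrefl _ this
    · have h2 : (X - C a : F[X]).coeff x = 0 := by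
        rw [coeff_sub, coeff_X, coeff_C, if_neg (by omega), if_neg (by omega), sub_zero]
      have := h 0 (by omega)
      rw [h2, map_zero, zero_mul] at this
      exact absurd this (not_lt.2 (mul_nonneg (v.nonneg _) (pow_nonneg (v.nonneg a) _)))

/-! ## §2 Dominant exponents of a product of linear factors -/

/-- **at a radius `t > 0` avoiding the root radii, the exponent `#{a ∈ m : v a < t}` strictly dominates `Π_{a ∈ m} (X − C a)`** (against
all indices), with a nonzero coefficient. [induction on `m` with `…Products.dominant_mul`] -/
theorem dominant_prod_roots (v : AbsoluteValue F ℝ) (hv : IsNonarchimedean v) {t : ℝ} (ht : 0 < t) :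
    ∀ m : Multiset F, (∀ a ∈ m, v a ≠ t) →
      ((m.map fun a => (X - C a : F[X])).prod.coeff (m.filter fun a => v a < t).card ≠ 0 ∧
        ∀ x : ℕ, x ≠ (m.filter fun a => v a < t).card →
          v ((m.map fun a => (X - C a : F[X])).prod.coeff x) * t ^ x
            < v ((m.map fun a => (X - C a : F[X])).prod.coeff (m.filter fun a => v a < t).card)
              * t ^ (m.filter fun a => v a < t).card) := by
  intro m
  induction m using Multiset.induction_on with
  | empty =>
    intro _
    simp only [Multiset.map_zero, Multiset.prod_zero, Multiset.filter_zero, Multiset.card_zero, coeff_one_zero]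
    refine ⟨one_ne_zero, fun x hx => ?_⟩
    rw [Polynomial.coeff_one, if_neg hx, map_zero, zero_mul, map_one, one_mul, pow_zero]
    exact one_pos
  | cons a m ih =>
    intro hm
    have hat : v a ≠ t := hm a (Multiset.mem_cons_self a m)
    obtain ⟨hne, hdom⟩ := ih fun b hb => hm b (Multiset.mem_cons_of_mem hb)
    rw [Multiset.map_cons, Multiset.prod_cons, Multiset.filter_cons]
    rcases lt_or_gt_of_ne hat with hlt | hgt
    · -- `v a < t`: the factor contributes its leading term
      have hone : (X - C a : F[X]).coeff 1 ≠ 0 := by simp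
      obtain ⟨hval, hd⟩ := dominant_mul v hv (X - C a) _ ht hone hne (dominantAt_X_sub_C_one v a hlt) hdom
      rw [if_pos hlt]
      simp only [Multiset.singleton_add, Multiset.card_cons]
      rw [Nat.add_comm _ 1] at *
      refine ⟨fun h0 => ?_, hd⟩
      rw [h0, map_zero] at hval
      exact absurd hval.symm (ne_of_gt (mul_pos (v.pos hone) (v.pos hne)))
    · -- `t < v a`: the factor contributes its constant term
      have hzero : (X - C a : F[X]).coeff 0 ≠ 0 := by
        simp only [coeff_sub, coeff_X_zero, coeff_C_zero, zero_sub, ne_eq, neg_eq_zero]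
        intro h0; rw [h0, map_zero] at hgt; exact absurd hgt (not_lt.2 ht.le)
      obtain ⟨hval, hd⟩ := dominant_mul v hv (X - C a) _ ht hzero hne (dominantAt_X_sub_C_zero v a ht hgt) hdom
      rw [if_neg (not_lt.2 hgt.le)]
      simp only [Multiset.zero_add]
      rw [Nat.zero_add] at hval hd
      refine ⟨fun h0 => ?_, hd⟩
      rw [h0, map_zero] at hval
      exact absurd hval.symm (ne_of_gt (mul_pos (v.pos hzero) (v.pos hne)))

/-- **no exponent is dominant at a root radius.** [split off the tying factor; `…Products.exists_dominant_pair_of_dominant_mul`] -/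
theorem not_dominantAt_rootRadius (v : AbsoluteValue F ℝ) (hv : IsNonarchimedean v) (m : Multiset F) {a : F} (ha : a ∈ m)
    (ha0 : a ≠ 0) (x : ℕ) (hx : (m.map fun a => (X - C a : F[X])).prod.coeff x ≠ 0) :
    ¬ ∀ x' : ℕ, x' ≠ x → v ((m.map fun a => (X - C a : F[X])).prod.coeff x') * (v a) ^ x'
        < v ((m.map fun a => (X - C a : F[X])).prod.coeff x) * (v a) ^ x := by
  intro h
  obtain ⟨m', rfl⟩ := Multiset.exists_cons_of_mem ha
  rw [Multiset.map_cons, Multiset.prod_cons] at h hx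
  obtain ⟨a', b', ha', -, -, hda, -⟩ := exists_dominant_pair_of_dominant_mul v hv (X - C a) _ (v.pos ha0) hx h
  exact not_dominantAt_X_sub_C v a a' hda

/-! ## §3 The values of the count `#{a ∈ m : v a < t}` -/

/-- a radius just above `ρ` avoiding all root radii: the count there is `#{a : v a ≤ ρ}`. [bookkeeping] -/
theorem exists_radius_above (v : AbsoluteValue F ℝ) (m : Multiset F) {ρ : ℝ} (hρ : 0 < ρ) :
    ∃ t : ℝ, 0 < t ∧ (∀ a ∈ m, v a ≠ t) ∧ (m.filter fun a => v a < t) = m.filter fun a => v a ≤ ρ := by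
  set R : Finset ℝ := ((m.map v).toFinset).filter fun x => ρ < x with hR
  by_cases hne : R.Nonempty
  · set ρ' := R.min' hne with hρ'
    have hρρ' : ρ < ρ' := (Finset.mem_filter.1 (Finset.min'_mem R hne)).2
    refine ⟨(ρ + ρ') / 2, by linarith, fun a ha h => ?_, ?_⟩
    · by_cases hle : v a ≤ ρ
      · linarith
      · have hmem : v a ∈ R := Finset.mem_filter.2 ⟨Multiset.mem_toFinset.2 (Multiset.mem_map_of_mem v ha), lt_of_not_ge hle⟩
        have := Finset.min'_le R (v a) hmem
        linarith
    · refine Multiset.filter_congr fun a ha => ⟨fun h => ?_, fun h => by linarith⟩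
      by_contra hle
      have hmem : v a ∈ R := Finset.mem_filter.2 ⟨Multiset.mem_toFinset.2 (Multiset.mem_map_of_mem v ha), lt_of_not_ge hle⟩
      have := Finset.min'_le R (v a) hmem
      linarith
  · refine ⟨ρ + 1, by linarith, fun a ha h => hne ⟨v a, Finset.mem_filter.2
      ⟨Multiset.mem_toFinset.2 (Multiset.mem_map_of_mem v ha), by linarith⟩⟩, ?_⟩
    refine Multiset.filter_congr fun a ha => ⟨fun h => ?_, fun h => by linarith⟩
    by_contra hle
    exact hne ⟨v a, Finset.mem_filter.2 ⟨Multiset.mem_toFinset.2 (Multiset.mem_map_of_mem v ha), lt_of_not_ge hle⟩⟩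

/-- a radius below all root radii (roots nonzero): the count there is `0`. [bookkeeping] -/
theorem exists_radius_below (v : AbsoluteValue F ℝ) (m : Multiset F) (h0 : ∀ a ∈ m, a ≠ 0) :
    ∃ t : ℝ, 0 < t ∧ (∀ a ∈ m, v a ≠ t) ∧ (m.filter fun a => v a < t) = 0 := by
  set R : Finset ℝ := (m.map v).toFinset with hR
  by_cases hne : R.Nonempty
  · set ρ := R.min' hne with hρ
    have hρpos : 0 < ρ := by
      obtain ⟨a, ha, hav⟩ := Multiset.mem_map.1 (Multiset.mem_toFinset.1 (Finset.min'_mem R hne))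
      rw [hρ, ← hav]; exact v.pos (h0 a ha)
    have hle : ∀ a ∈ m, ρ ≤ v a := fun a ha =>
      Finset.min'_le R (v a) (Multiset.mem_toFinset.2 (Multiset.mem_map_of_mem v ha))
    refine ⟨ρ / 2, by linarith, fun a ha h => ?_, ?_⟩
    · have := hle a ha; linarith
    · rw [Multiset.filter_eq_nil]
      intro a ha h
      have := hle a ha; linarith
  · refine ⟨1, one_pos, fun a ha _ => hne ⟨v a, Multiset.mem_toFinset.2 (Multiset.mem_map_of_mem v ha)⟩, ?_⟩
    rw [Multiset.filter_eq_nil]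
    intro a ha _
    exact hne ⟨v a, Multiset.mem_toFinset.2 (Multiset.mem_map_of_mem v ha)⟩

/-- at a radius avoiding the root radii the count `#{a : v a < t}` is `0` or `#{a : v a ≤ ρ}` for a root radius `ρ`. [bookkeeping] -/
theorem count_lt_mem (v : AbsoluteValue F ℝ) (m : Multiset F) (t : ℝ) :
    (m.filter fun a => v a < t).card ∈
      insert 0 (((m.map v).toFinset).image fun ρ => (m.filter fun a => v a ≤ ρ).card) := by
  set R : Finset ℝ := ((m.map v).toFinset).filter fun x => x < t with hR
  by_cases hne : R.Nonempty
  · set ρ := R.max' hne with hρ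
    have hρR := Finset.max'_mem R hne
    refine Finset.mem_insert_of_mem (Finset.mem_image.2 ⟨ρ, (Finset.mem_filter.1 hρR).1, ?_⟩)
    congr 1
    refine Multiset.filter_congr fun a ha => ⟨fun h => ?_, fun h => ?_⟩
    · exact h.trans_lt (Finset.mem_filter.1 hρR).2
    · exact Finset.le_max' R (v a) (Finset.mem_filter.2 ⟨Multiset.mem_toFinset.2 (Multiset.mem_map_of_mem v ha), h⟩)
  · refine Finset.mem_insert.2 (Or.inl ?_)
    rw [Multiset.card_eq_zero, Multiset.filter_eq_nil]
    intro a ha h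
    exact hne ⟨v a, Finset.mem_filter.2 ⟨Multiset.mem_toFinset.2 (Multiset.mem_map_of_mem v ha), h⟩⟩

/-! ## §4 The Newton polygon dictionary -/

/-- **`domCount (C c · Π_{a∈m} (X − C a)) = 1 + #{v a : a ∈ m}`** for `c ≠ 0`, `0 ∉ m`, non-archimedean `v` (raw predicate): the
number of dominant exponents is one more than the number of distinct root absolute values. [Newton polygon folklore] -/
theorem domCount_C_mul_prod_roots (v : AbsoluteValue F ℝ) (hv : IsNonarchimedean v) (c : F) (hc : c ≠ 0) (m : Multiset F)
    (h0 : ∀ a ∈ m, a ≠ 0) :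
    ((C c * (m.map fun a => (X - C a : F[X])).prod).support.filter fun E => ∃ r : ℝ, 0 < r ∧
        ∀ E' ∈ (C c * (m.map fun a => (X - C a : F[X])).prod).support, E' ≠ E →
          v ((C c * (m.map fun a => (X - C a : F[X])).prod).coeff E') * r ^ E'
            < v ((C c * (m.map fun a => (X - C a : F[X])).prod).coeff E) * r ^ E).card
      = ((m.map v).toFinset).card + 1 := by
  rw [dominant_C_mul v _ hc]
  set g : F[X] := (m.map fun a => (X - C a : F[X])).prod with hg
  set D := g.support.filter fun E => ∃ r : ℝ, 0 < r ∧ ∀ E' ∈ g.support, E' ≠ E →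
      v (g.coeff E') * r ^ E' < v (g.coeff E) * r ^ E with hD
  set cnt : ℝ → ℕ := fun ρ => (m.filter fun a => v a ≤ ρ).card with hcnt
  set T : Finset ℕ := insert 0 (((m.map v).toFinset).image cnt) with hT
  -- (⊆) every dominant exponent is a count at a radius avoiding the root radii
  have hsub : D ⊆ T := by
    intro E hE
    obtain ⟨hEs, r, hr, hdom⟩ := Finset.mem_filter.1 hE
    have hEne : g.coeff E ≠ 0 := Polynomial.mem_support_iff.1 hEs
    -- dominance against all indices
    have hdom' : ∀ x : ℕ, x ≠ E → v (g.coeff x) * r ^ x < v (g.coeff E) * r ^ E := by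
      intro x hx
      by_cases hxs : x ∈ g.support
      · exact hdom x hxs hx
      · rw [Polynomial.notMem_support_iff.1 hxs, map_zero, zero_mul]
        exact mul_pos (v.pos hEne) (pow_pos hr E)
    -- `r` is not a root radius
    have hr' : ∀ a ∈ m, v a ≠ r := by
      intro a ha har
      have := not_dominantAt_rootRadius v hv m ha (h0 a ha) E hEne
      rw [har] at this
      exact this hdom'
    -- so `E` is the count at `r`
    obtain ⟨-, hdomE⟩ := dominant_prod_roots v hv hr m hr'
    have hEeq : E = (m.filter fun a => v a < r).card := by
      by_contra hne
      have h1 := hdom' _ (Ne.symm hne)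
      have h2 := hdomE E hne
      exact absurd (h1.trans h2) (lt_irrefl _)
    rw [hEeq]
    exact count_lt_mem v m r
  -- (⊇) every count is dominant
  have hsup : T ⊆ D := by
    intro E hE
    rcases Finset.mem_insert.1 hE with rfl | hE'
    · obtain ⟨t, ht, htm, hcount⟩ := exists_radius_below v m h0
      obtain ⟨hne, hdomE⟩ := dominant_prod_roots v hv ht m htm
      rw [hcount, Multiset.card_zero] at hne hdomE
      exact Finset.mem_filter.2 ⟨Polynomial.mem_support_iff.2 hne, t, ht, fun E' _ hE'ne => hdomE E' hE'ne⟩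
    · obtain ⟨ρ, hρ, rfl⟩ := Finset.mem_image.1 hE'
      obtain ⟨a, ha, rfl⟩ := Multiset.mem_map.1 (Multiset.mem_toFinset.1 hρ)
      obtain ⟨t, ht, htm, hcount⟩ := exists_radius_above v m (v.pos (h0 a ha))
      obtain ⟨hne, hdomE⟩ := dominant_prod_roots v hv ht m htm
      rw [hcount] at hne hdomE
      exact Finset.mem_filter.2 ⟨Polynomial.mem_support_iff.2 hne, t, ht, fun E' _ hE'ne => hdomE E' hE'ne⟩
  have hDT : D = T := Finset.Subset.antisymm hsub hsup
  -- counting `T`: `cnt` is injective on the root radii and never `0` there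
  have hcnt_pos : ∀ ρ ∈ (m.map v).toFinset, 0 < cnt ρ := by
    intro ρ hρ
    obtain ⟨a, ha, rfl⟩ := Multiset.mem_map.1 (Multiset.mem_toFinset.1 hρ)
    exact Multiset.card_pos_iff_exists_mem.2 ⟨a, Multiset.mem_filter.2 ⟨ha, le_rfl⟩⟩
  have hcnt_inj : Set.InjOn cnt ((m.map v).toFinset : Set ℝ) := by
    have hmono : ∀ ρ ρ' : ℝ, ρ' ∈ (m.map v).toFinset → ρ < ρ' → cnt ρ < cnt ρ' := by
      intro ρ ρ' hρ' hlt
      obtain ⟨a, ha, rfl⟩ := Multiset.mem_map.1 (Multiset.mem_toFinset.1 hρ')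
      have hle : (m.filter fun b => v b ≤ ρ) ≤ m.filter fun b => v b ≤ v a :=
        Multiset.monotone_filter_right m fun b (hb : v b ≤ ρ) => hb.trans hlt.le
      refine lt_of_le_of_ne (Multiset.card_le_card hle) fun heq => ?_
      have hmem : a ∈ m.filter fun b => v b ≤ v a := Multiset.mem_filter.2 ⟨ha, le_rfl⟩
      have hnot : a ∉ m.filter fun b => v b ≤ ρ := fun h => absurd (Multiset.mem_filter.1 h).2 (not_le.2 hlt)
      have := Multiset.eq_of_le_of_card_le hle (le_of_eq heq.symm)
      rw [this] at hnot
      exact hnot hmem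
    intro ρ hρ ρ' hρ' h
    rcases lt_trichotomy ρ ρ' with hlt | heq | hgt
    · exact absurd h (ne_of_lt (hmono ρ ρ' hρ' hlt))
    · exact heq
    · exact absurd h.symm (ne_of_lt (hmono ρ' ρ hρ hgt))
  rw [hDT, hT, Finset.card_insert_of_notMem, Finset.card_image_of_injOn hcnt_inj]
  intro h0mem
  obtain ⟨ρ, hρ, h0⟩ := Finset.mem_image.1 h0mem
  exact absurd h0 (ne_of_gt (hcnt_pos ρ hρ))

/-- **THE NEWTON POLYGON DICTIONARY, split case:** for a split polynomial `f` with `f(0) ≠ 0` and non-archimedean `v`,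
`domCount v f = 1 + #{v α : f(α) = 0}` — so `npEdges v f` is the number of distinct absolute values of the roots of `f`.
[Newton polygon folklore; `Polynomial.Splits.eq_prod_roots`] -/
theorem domCount_of_splits (v : AbsoluteValue F ℝ) (hv : IsNonarchimedean v) (f : F[X]) (hf : f.Splits) (h0 : f.eval 0 ≠ 0) :
    (f.support.filter fun E => ∃ r : ℝ, 0 < r ∧ ∀ E' ∈ f.support, E' ≠ E →
        v (f.coeff E') * r ^ E' < v (f.coeff E) * r ^ E).card = ((f.roots.map v).toFinset).card + 1 := by
  have hf0 : f ≠ 0 := fun h => h0 (by rw [h, eval_zero])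
  have hc : f.leadingCoeff ≠ 0 := leadingCoeff_ne_zero.2 hf0
  have hroots : ∀ a ∈ f.roots, a ≠ 0 := by
    intro a ha ha0
    rw [ha0, mem_roots hf0, IsRoot.def] at ha
    exact h0 ha
  have key := domCount_C_mul_prod_roots v hv f.leadingCoeff hc f.roots hroots
  rw [← hf.eq_prod_roots] at key
  exact key

end Summit.ValiantsHypothesis.ValiantsHypothesis.Theorems.KPlusLogSqLaw.ValDoor
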